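import Literature.Geometry.Kaehler.ComplexTorusAnalyticMovingLemma
import Literature.Geometry.Kaehler.ComplexTorusAnalyticLimitCycleClass
import Literature.Geometry.Kaehler.ComplexTorusAnalyticCycleClassNonzero
import Literature.Geometry.Kaehler.ComplexTorusAnalyticCycleClassComponents
import Literature.Geometry.Kaehler.ComplexTorusEffectiveCycleBoundedDegree
import Literature.Geometry.Kaehler.ComplexTorusAnalyticProperIntersectionTranslates
import HarnessLib

/-!
# The intersection cycle: `[Y₁] · [Y₂]` is the class of an effective analytic cycle supported on `Y₁ ∩ Y₂`

Let `X = E/Λ` be a complex torus of dimension `g` and `Y₁, Y₂ ⊆ X` closed analytic subsets of pure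
dimensions `d₁, d₂` (codimensions `p₁, p₂`) with positive expected dimension `q + 1 = d₁ + d₂ − g`.
Fulton's DYNAMIC INTERSECTION (Ch. 11: "the limit cycle `lim_{t → 0} (X_t · V)` is a well-defined cycle
on `X ∩ V` representing `X · V`"; Example 11.4.5 for translates by a group acting transitively) takes
here the following analytic form, proved in this file:

* `ComplexTorus.exists_effectiveCycle_wedge_analyticCycleClass_eq` — **THE INTERSECTION CYCLE**: there is
  an EFFECTIVE analytic `(q+1)`-cycle `S = Σ m_ν W_ν` of `X` (`HolomorphicChain`, `m_ν ≥ 0`, `W_ν`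
  irreducible closed analytic of dimension `q + 1`) SUPPORTED ON `Y₁ ∩ Y₂` with
  `[Y₁]_e ∧ [Y₂]_e = sign(e) · cl_e(S)`.
  Proof: by the moving lemma (`ComplexTorusAnalyticMovingLemma`) the translates `Y₁ ∩ (Y₂ − t)` for
  Haar-a.e. `t` have pure dimension `q + 1` and the constant class `sign(e) [Y₁] ∧ [Y₂]` (or `[Y₁] ∧ [Y₂] = 0`,
  `S = 0`); a full-measure set is dense, so there are such `t_j → 0`; the volumes `vol(Y₁ ∩ (Y₂ − t_j))`
  all equal the degree of that class (Wirtinger), so Bishop's compactness in class form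
  (`exists_subseq_effectiveCycle_of_measure_le`) yields an effective cycle `S` with `cl(S)` the common
  class and `|S|` the limit set of a subsequence — which lies in `Y₁` (closed) and in `Y₂` (`t_j → 0`,
  `mem_of_forall_mem_closure_iUnion_translate`).
* `wedge_analyticCycleClass_eq_zero_of_inter_eq_empty` — `Y₁ ∩ Y₂ = ∅ ⟹ [Y₁] ∧ [Y₂] = 0`;
  `exists_irreducible_subset_inter_of_wedge_ne_zero` — `[Y₁] ∧ [Y₂] ≠ 0 ⟹ Y₁ ∩ Y₂` contains an
  irreducible closed analytic subset of dimension `q + 1` (so `Y₁ ∩ Y₂ ≠ ∅` and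
  `dim(Y₁ ∩ Y₂) ≥ d₁ + d₂ − g` somewhere: the dimension of a non-empty "homologically essential"
  intersection cannot drop below the expected one).

* §4 PROPER INTERSECTIONS: when `Y₁ ∩ Y₂` has pure dimension `q + 1`, the components of `S` are
  irreducible analytic subsets of `Y₁ ∩ Y₂` of full dimension, i.e. irreducible components, so
  **`[Y₁]_e ∧ [Y₂]_e = sign(e) · Σ_C i(C) cl_e(C)`** over the (finitely many) irreducible components `C`
  of `Y₁ ∩ Y₂` with INTEGERS `i(C) ≥ 0` (`exists_wedge_analyticCycleClass_eq_sum_isIrreducibleComponent`)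
  — Fulton's `Y₁ · Y₂ = Σ i(C; Y₁ · Y₂) [C]` (§7.1, §8.2) up to the positivity `i(C) ≥ 1` of the
  intersection multiplicities (Prop. 7.1 (a)), which is not proved here; for an irreducible proper
  intersection, `[Y₁] ∧ [Y₂] = sign(e) · m · [Y₁ ∩ Y₂]` with `m ∈ ℕ`
  (`exists_wedge_analyticCycleClass_eq_natCast_smul_of_isIrreducible`).

* §5 NUMERICAL POSITIVITY (Fulton §12.2 for tori: `T_X` is trivial, hence generated by its sections, so
  every intersection product of subvarieties is represented by a non-negative cycle, Cor. 12.2 (a) and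
  Example 12.2.1 (a)): the degree `Re ⟨ω^{q+1}/(q+1)!, sign(e) [Y₁] ∧ [Y₂]⟩ = deg S = Σ m_ν vol(W_ν)` is
  `≥ 0` (`re_poincarePairing_kaehlerPow_smul_wedge_nonneg`), and `> 0` iff `[Y₁] ∧ [Y₂] ≠ 0`
  (`re_poincarePairing_kaehlerPow_smul_wedge_pos_iff`).

* §6 POSITIVITY OF THE INTERSECTION MULTIPLICITIES (Fulton §7.1 Prop. 7.1 (a): "If `β` is a proper
  component of `W ∩ V`, then `1 ≤ i(β)`"): for a PROPER intersection the intersection cycle can be chosen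
  with support EXACTLY `Y₁ ∩ Y₂` (`exists_effectiveCycle_wedge_analyticCycleClass_eq_support_eq`): every
  point of `Y₁ ∩ Y₂` is a limit of points of `Y₁ ∩ (Y₂ − t_j)`, `t_j → 0`, by Remmert's open mapping
  theorem for the subtraction map (`ComplexTorusAnalyticProperIntersectionTranslates`), so it lies in the
  limit set `|S|`. Hence **`[Y₁]_e ∧ [Y₂]_e = sign(e) · Σ_C i(C) cl_e(C)` with `1 ≤ i(C)` for EVERY irreducible
  component `C` of `Y₁ ∩ Y₂`** (`exists_wedge_analyticCycleClass_eq_sum_isIrreducibleComponent_pos`), the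
  irreducible case `[Y₁] ∧ [Y₂] = sign(e) · m · [Y₁ ∩ Y₂]` with `1 ≤ m`
  (`exists_wedge_analyticCycleClass_eq_succ_smul_of_isIrreducible`), and a non-empty proper intersection has
  `[Y₁] ∧ [Y₂] ≠ 0` and positive degree (`wedge_analyticCycleClass_ne_zero_of_hasPureDim_inter`,
  `re_poincarePairing_kaehlerPow_smul_wedge_pos_of_hasPureDim_inter`).

* §7 PROPER POINTS OF AN ARBITRARY INTERSECTION (Fulton §7.1: the proper components among all
  components of `W ∩ V`): a point `z ∈ Y₁ ∩ Y₂` at which `Y₁ ∩ Y₂` has the expected dimension `q + 1`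
  forces `[Y₁] ∧ [Y₂] ≠ 0` (`wedge_analyticCycleClass_ne_zero_of_codim_le`: small generic translates are
  non-empty near `z`, of pure dimension `q + 1` and of class `± [Y₁] ∧ [Y₂]`), and the intersection cycle can
  be chosen to contain EVERY such point in its support
  (`exists_effectiveCycle_wedge_analyticCycleClass_eq_support_supset`).

* §8 `[Y₁] ∧ [Y₂] ≠ 0` IFF ALL TRANSLATES MEET: `wedge_analyticCycleClass_ne_zero_iff_forall_inter_vadd_nonempty`
  (`[Y₁] ∧ [Y₂] ≠ 0 ⟺ Y₁ ∩ (t + Y₂) ≠ ∅` for every `t ∈ X`; ⟹ by translation invariance of the class and §3,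
  ⟸ by Kleiman (a) a.e. and the moving lemma), `wedge_analyticCycleClass_eq_zero_iff_exists_inter_vadd_eq_empty`
  (the product vanishes iff `Y₂` can be translated off `Y₁`).

TODO(q + 1 = 0): intersection numbers, see `ComplexTorusAnalyticMovingLemma`.

Theorems only; no definitions, no instances, no named facts.

## References

* [Fulton1998] W. Fulton, *Intersection Theory*, 2nd ed., Springer 1998, §7.1 (Prop. 7.1), §8.2, §11.1 (limit
  cycles; Cor. 11.1, Remark 11.1), §11.2, Example 11.4.5, §12.2 (Cor. 12.2 (a), Example 12.2.1 (a):
  positivity when `T_X` is generated by sections), §19.2.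
* [Fischer1976] G. Fischer, *Complex Analytic Geometry*, LNM 538, Springer 1976, §3.9 Prop. (open mapping).
* [Kleiman1974Transversality] S. L. Kleiman, *The transversality of a general translate*, Compositio
  Math. 28 (1974) 287–297.
* [Chirka1989] E. M. Chirka, *Complex Analytic Sets*, Kluwer 1989, §12.2–12.3 (intersection indices via
  limits), §15.5 Cor., §16.1 Prop. 1.
* [Fujiki1978] A. Fujiki, *Closedness of the Douady spaces of compact Kähler spaces*, Publ. RIMS 14
  (1978), §4 Prop. 4.1.
* [Lange2023AbelianVarietiesComplex] H. Lange, *Abelian Varieties over the Complex Numbers*, Springer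
  2023, §6.2.1, §7.3.1.
* [VoisinHodgeI2002] C. Voisin, *Hodge Theory and Complex Algebraic Geometry I*, CUP 2002, §3.1.3
  (Wirtinger), §11.1.2.
-/

noncomputable section

open scoped Manifold Topology ENNReal NNReal
open MeasureTheory MeasureTheory.Measure Set Function Filter Module TopologicalSpace WithLp Metric Complex
open Literature.Geometry.GeometricMeasureTheory Literature.Analysis.Complex Literature.LinearAlgebra.Alternating

universe u

namespace Literature.Geometry.Kaehler

-- Nested operator-norm instances on `V [⋀^Fin m]→L[ℝ] F`, as in the tree's `Currents*.lean` files.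
set_option maxSynthPendingDepth 2

namespace ComplexTorus

variable {ι : Type*} [Fintype ι] [DecidableEq ι] {E : Type u} [NormedAddCommGroup E] [InnerProductSpace ℂ E]
  [FiniteDimensional ℂ E] [MeasurableSpace E] [BorelSpace E] (Φ : (ι → ℝ) ≃L[ℝ] E) {n : ℕ} (e : Fin n ≃ ι)
  {d₁ d₂ p₁ p₂ q : ℕ}

/-! ### §1 Limit points of shrinking translates -/

omit [Fintype ι] [DecidableEq ι] [FiniteDimensional ℂ E] [MeasurableSpace E] [BorelSpace E] in
/-- **Limit points of `Y − t_j` with `t_j → 0` lie in the closed set `Y`**: if `z` is, for every `N`,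
in the closure of `⋃_{j ≥ N} (Y − t_j)`, then `z ∈ Y` (addition is continuous and `Y` is closed:
a neighbourhood `U × V` of `(z, 0)` with `U + V` off `Y` eventually contains the `t_j`).
[cite: Fulton1998, §11.1 (the limit set lies over `t = 0`)] -/
theorem mem_of_forall_mem_closure_iUnion_translate {Y : Set (ComplexTorus Φ)} (hY : IsClosed Y)
    {t : ℕ → ComplexTorus Φ} (ht : Tendsto t atTop (𝓝 0)) {z : ComplexTorus Φ}
    (hz : ∀ N : ℕ, z ∈ closure (⋃ j ≥ N, (fun x ↦ x + t j) ⁻¹' Y)) : z ∈ Y := by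
  by_contra hzY
  have hopen : IsOpen ((fun w : ComplexTorus Φ × ComplexTorus Φ ↦ w.1 + w.2) ⁻¹' Yᶜ) :=
    hY.isOpen_compl.preimage continuous_add
  have hmem : (z, (0 : ComplexTorus Φ)) ∈ (fun w : ComplexTorus Φ × ComplexTorus Φ ↦ w.1 + w.2) ⁻¹' Yᶜ := by
    rw [mem_preimage, add_zero]
    exact hzY
  obtain ⟨U, V, hU, hV, hzU, h0V, hUV⟩ := isOpen_prod_iff.1 hopen z 0 hmem
  obtain ⟨N, hN⟩ := eventually_atTop.1 (ht.eventually (hV.mem_nhds h0V))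
  have hdisj : U ∩ (⋃ j ≥ N, (fun x ↦ x + t j) ⁻¹' Y) = ∅ := by
    refine eq_empty_of_forall_notMem fun x hx ↦ ?_
    obtain ⟨hxU, hx⟩ := hx
    simp only [mem_iUnion, mem_preimage, exists_prop] at hx
    obtain ⟨j, hj, hxY⟩ := hx
    exact hUV (mk_mem_prod hxU (hN j hj)) hxY
  have hne := mem_closure_iff_nhds.1 (hz N) U (hU.mem_nhds hzU)
  rw [hdisj] at hne
  exact Set.not_nonempty_empty hne

/-! ### §2 The intersection cycle -/

open Classical in
/-- **THE INTERSECTION CYCLE: `[Y₁] ∧ [Y₂]` is `±` the class of an EFFECTIVE analytic cycle supported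
on `Y₁ ∩ Y₂`.** For closed analytic `Y₁, Y₂ ⊆ X` of pure dimensions `d₁, d₂`, codimensions `p₁, p₂`,
and expected dimension `q + 1 = d₁ + d₂ − dim X ≥ 1`, there is a holomorphic `(q+1)`-chain `S ≥ 0` of
`X` with `|S| ⊆ Y₁ ∩ Y₂` and `[Y₁]_e ∧ [Y₂]_e = sign(e) · cl_e(S)` (`sign(e) = 1` for a positively
oriented enumeration). Fulton: the limit `lim_{t→0} [Y₁ ∩ (Y₂ − t)]` of the generic-translate
intersections (moving lemma) exists as an effective cycle on `Y₁ ∩ Y₂` and represents `Y₁ · Y₂`; here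
the limit is Bishop's (bounded volume = constant degree, `exists_subseq_effectiveCycle_of_measure_le`).
[cite: Fulton1998, §11.1 Cor. 11.1 and Example 11.4.5] [cite: Chirka1989, §16.1 Prop. 1 and §12.3]
[cite: Kleiman1974Transversality, Thm. 2] [cite: Lange2023AbelianVarietiesComplex, §7.3.1] -/
theorem exists_effectiveCycle_wedge_analyticCycleClass_eq (hk₁ : 2 * d₁ + 2 * p₁ = n) (hk₂ : 2 * d₂ + 2 * p₂ = n)
    (hq : 2 * (q + 1) + 2 * (p₁ + p₂) = n) {Y₁ Y₂ : Set (ComplexTorus Φ)}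
    (hY₁ : HasPureDim 𝓘(ℂ, E) Y₁ d₁) (hY₂ : HasPureDim 𝓘(ℂ, E) Y₂ d₂) :
    ∃ S : HolomorphicChain 𝓘(ℂ, E) (ComplexTorus Φ) (q + 1),
      (∀ W, 0 ≤ S.mult W) ∧ S.support ⊆ Y₁ ∩ Y₂ ∧
        ((analyticCycleClass Φ e hk₁ hY₁).wedge (analyticCycleClass Φ e hk₂ hY₂)).domDomCongr
            (finCongr (by ring : 2 * p₁ + 2 * p₂ = 2 * (p₁ + p₂))) =
          (orientationSign Φ e : ℂ) • chainCycleClass Φ e hq S := by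
  have hs : ((orientationSign Φ e : ℤ) : ℂ) * orientationSign Φ e = 1 := by
    exact_mod_cast orientationSign_mul_self Φ e
  by_cases h0 : (analyticCycleClass Φ e hk₁ hY₁).wedge (analyticCycleClass Φ e hk₂ hY₂) = 0
  · refine ⟨0, fun W ↦ by simp, by simp, ?_⟩
    rw [chainCycleClass_zero, smul_zero, h0, domDomCongr_finCongr_zero]
  -- generic translates `Y₁ ∩ (Y₂ - t)`: pure dimension `q + 1` and the constant class `sign(e) [Y₁] ∧ [Y₂]`
  have hpure := (wedge_analyticCycleClass_ne_zero_iff_ae_hasPureDim_inter_translate Φ e hk₁ hk₂ hq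
    (Nat.succ_pos q) hY₁ hY₂).1 h0
  have hcl := ae_wedge_analyticCycleClass_eq_smul_setCycleClass_inter_translate Φ e hk₁ hk₂ hq
    (Nat.succ_pos q) hY₁ hY₂
  -- a full-measure set is dense: pick such translates `t j → 0`
  have hdense := Measure.dense_of_ae (hpure.and hcl)
  obtain ⟨t, htG, ht0⟩ := mem_closure_iff_seq_limit.1 (hdense (0 : ComplexTorus Φ))
  have hZ : ∀ j, HasPureDim 𝓘(ℂ, E) (Y₁ ∩ (fun x ↦ x + t j) ⁻¹' Y₂) (q + 1) := fun j ↦ (htG j).1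
  have hclass : ∀ j, analyticCycleClass Φ e hq (hZ j) =
      (orientationSign Φ e : ℂ) •
        ((analyticCycleClass Φ e hk₁ hY₁).wedge (analyticCycleClass Φ e hk₂ hY₂)).domDomCongr
          (finCongr (by ring : 2 * p₁ + 2 * p₂ = 2 * (p₁ + p₂))) := by
    intro j
    have h := (htG j).2
    rw [setCycleClass_of_hasPureDim Φ e hq (hZ j)] at h
    rw [h, smul_smul, hs, one_smul]
  -- uniform volume bound: by Wirtinger every `Y₁ ∩ (Y₂ - t j)` has the volume of the common class
  obtain ⟨V, hV⟩ : ∃ V : ℝ, ∀ j,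
      (μHE[2 * (q + 1)] : Measure E).real (periodBox Φ 0 ∩ (analyticChain Φ (hZ j)).carrier) = V := by
    refine ⟨(poincarePairing Φ e hq (ofRealCLM.compContinuousAlternatingMap (kaehlerPow (q + 1)))
      ((orientationSign Φ e : ℂ) •
        ((analyticCycleClass Φ e hk₁ hY₁).wedge (analyticCycleClass Φ e hk₂ hY₂)).domDomCongr
          (finCongr (by ring : 2 * p₁ + 2 * p₂ = 2 * (p₁ + p₂))))).re, fun j ↦ ?_⟩
    have h := poincarePairing_kaehlerPow_analyticCycleClass Φ e hq (hZ j)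
    rw [hclass j] at h
    rw [h, Complex.ofReal_re]
  have hvol : ∀ j, (μHE[2 * (q + 1)] : Measure E)
      (cover Φ ⁻¹' (Y₁ ∩ (fun x ↦ x + t j) ⁻¹' Y₂) ∩ periodBox Φ 0) ≤ ENNReal.ofReal V := by
    intro j
    have heq : (μHE[2 * (q + 1)] : Measure E) (cover Φ ⁻¹' (Y₁ ∩ (fun x ↦ x + t j) ⁻¹' Y₂) ∩ periodBox Φ 0) =
        (μHE[2 * (q + 1)] : Measure E) (periodBox Φ 0 ∩ (analyticChain Φ (hZ j)).carrier) := by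
      rw [← image_val_liftSet, analyticChain,
        HolomorphicChain.measure_image_inter_eq_carrier_inter (hasPureDim_liftSet Φ (hZ j)), inter_comm]
    rw [heq, ← ENNReal.ofReal_toReal (measure_periodBox_inter_carrier_lt_top Φ (hZ j) 0).ne, ← measureReal_def,
      hV j]
  -- Bishop: a subsequence converges to an effective cycle with the same class, supported on the limit set
  obtain ⟨κ, S, hκ, hS0, -, hsupp, hclS, -⟩ :=
    exists_subseq_effectiveCycle_of_measure_le Φ hZ e hq ENNReal.ofReal_lt_top hvol
  refine ⟨S, hS0, fun z hz ↦ ?_, ?_⟩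
  · have hz' := (hsupp z).1 hz
    refine ⟨?_, ?_⟩
    · have h1 : closure (⋃ j ≥ (0 : ℕ), Y₁ ∩ (fun x ↦ x + t (κ j)) ⁻¹' Y₂) ⊆ Y₁ :=
        closure_minimal (iUnion₂_subset fun j _ ↦ inter_subset_left) hY₁.isAnalyticSet.isClosed
      exact h1 (hz' 0)
    · refine mem_of_forall_mem_closure_iUnion_translate Φ hY₂.isAnalyticSet.isClosed
        (ht0.comp hκ.tendsto_atTop) fun N ↦ ?_
      exact closure_mono (iUnion₂_mono fun j _ ↦ inter_subset_right) (hz' N)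
  · obtain ⟨j, hj⟩ := hclS.exists
    rw [← hj, hclass, smul_smul, hs, one_smul]

/-! ### §3 Consequences: disjoint subsets multiply to zero; essential intersections have the expected dimension -/

open Classical in
/-- **`Y₁ ∩ Y₂ = ∅ ⟹ [Y₁] ∧ [Y₂] = 0`** (expected dimension `q + 1 ≥ 1`): the intersection cycle is
supported on `Y₁ ∩ Y₂`, so it is `0`. [cite: Fulton1998, §11.1 Cor. 11.1 and Example 11.4.5]
[cite: Chirka1989, §16.1 Prop. 1] -/
theorem wedge_analyticCycleClass_eq_zero_of_inter_eq_empty (hk₁ : 2 * d₁ + 2 * p₁ = n)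
    (hk₂ : 2 * d₂ + 2 * p₂ = n) (hq : 2 * (q + 1) + 2 * (p₁ + p₂) = n) {Y₁ Y₂ : Set (ComplexTorus Φ)}
    (hY₁ : HasPureDim 𝓘(ℂ, E) Y₁ d₁) (hY₂ : HasPureDim 𝓘(ℂ, E) Y₂ d₂) (h : Y₁ ∩ Y₂ = ∅) :
    (analyticCycleClass Φ e hk₁ hY₁).wedge (analyticCycleClass Φ e hk₂ hY₂) = 0 := by
  obtain ⟨S, hS0, hsupp, hcl⟩ := exists_effectiveCycle_wedge_analyticCycleClass_eq Φ e hk₁ hk₂ hq hY₁ hY₂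
  rw [h, subset_empty_iff] at hsupp
  -- a chain with empty support has no components
  have hS : S.components ⊆ (∅ : Finset (Set (ComplexTorus Φ))) := by
    intro Z hZ
    have hne := (S.isIrreducibleAnalyticSet_and_hasPureDim hZ).2.nonempty
    obtain ⟨z, hz⟩ := hne
    have : z ∈ S.support := HolomorphicChain.subset_support (HolomorphicChain.mem_components_iff.1 hZ) hz
    rw [hsupp] at this
    exact this.elim
  rw [chainCycleClass_eq_sum_of_subset Φ e hq S hS, Finset.sum_empty, smul_zero,
    domDomCongr_finCongr_eq_zero_iff] at hcl
  exact hcl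

open Classical in
/-- **`[Y₁] ∧ [Y₂] ≠ 0 ⟹ Y₁ ∩ Y₂` contains an irreducible closed analytic subset of the expected
dimension `q + 1 = d₁ + d₂ − dim X`** (a component of the intersection cycle): a homologically
non-trivial intersection is non-empty and nowhere of dimension below the expected one along that
component. [cite: Fulton1998, §11.1 Cor. 11.1, §8.2 (expected dimension) and Example 11.4.5]
[cite: Chirka1989, §16.1 Prop. 1] -/
theorem exists_irreducible_subset_inter_of_wedge_ne_zero (hk₁ : 2 * d₁ + 2 * p₁ = n)
    (hk₂ : 2 * d₂ + 2 * p₂ = n) (hq : 2 * (q + 1) + 2 * (p₁ + p₂) = n) {Y₁ Y₂ : Set (ComplexTorus Φ)}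
    (hY₁ : HasPureDim 𝓘(ℂ, E) Y₁ d₁) (hY₂ : HasPureDim 𝓘(ℂ, E) Y₂ d₂)
    (h : (analyticCycleClass Φ e hk₁ hY₁).wedge (analyticCycleClass Φ e hk₂ hY₂) ≠ 0) :
    ∃ W ⊆ Y₁ ∩ Y₂, IsIrreducibleAnalyticSet 𝓘(ℂ, E) W ∧ HasPureDim 𝓘(ℂ, E) W (q + 1) := by
  obtain ⟨S, hS0, hsupp, hcl⟩ := exists_effectiveCycle_wedge_analyticCycleClass_eq Φ e hk₁ hk₂ hq hY₁ hY₂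
  -- `S ≠ 0`: otherwise `[Y₁] ∧ [Y₂] = 0`
  by_cases hS : S.components = ∅
  · exfalso
    apply h
    have hsub : S.components ⊆ (∅ : Finset (Set (ComplexTorus Φ))) := by rw [hS]; simp
    rw [chainCycleClass_eq_sum_of_subset Φ e hq S hsub, Finset.sum_empty, smul_zero,
      domDomCongr_finCongr_eq_zero_iff] at hcl
    exact hcl
  · obtain ⟨W, hW⟩ := Set.nonempty_iff_ne_empty.2 hS
    exact ⟨W, (HolomorphicChain.subset_support (HolomorphicChain.mem_components_iff.1 hW)).trans hsupp,
      S.isIrreducibleAnalyticSet_and_hasPureDim hW⟩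

open Classical in
/-- **`[Y₁] ∧ [Y₂] ≠ 0 ⟹ Y₁ ∩ Y₂ ≠ ∅`** (expected dimension `≥ 1`).
[cite: Fulton1998, §11.1 Cor. 11.1 and Example 11.4.5] -/
theorem inter_nonempty_of_wedge_analyticCycleClass_ne_zero (hk₁ : 2 * d₁ + 2 * p₁ = n)
    (hk₂ : 2 * d₂ + 2 * p₂ = n) (hq : 2 * (q + 1) + 2 * (p₁ + p₂) = n) {Y₁ Y₂ : Set (ComplexTorus Φ)}
    (hY₁ : HasPureDim 𝓘(ℂ, E) Y₁ d₁) (hY₂ : HasPureDim 𝓘(ℂ, E) Y₂ d₂)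
    (h : (analyticCycleClass Φ e hk₁ hY₁).wedge (analyticCycleClass Φ e hk₂ hY₂) ≠ 0) :
    (Y₁ ∩ Y₂).Nonempty := by
  obtain ⟨W, hW, -, hWd⟩ := exists_irreducible_subset_inter_of_wedge_ne_zero Φ e hk₁ hk₂ hq hY₁ hY₂ h
  exact hWd.nonempty.mono hW

/-! ### §4 Proper intersections: `[Y₁] · [Y₂] = Σ_C i(C) [C]` over the irreducible components of `Y₁ ∩ Y₂` -/

open Classical in
/-- **PROPER INTERSECTIONS: `[Y₁]_e ∧ [Y₂]_e = sign(e) · Σ_C i(C) cl_e(C)`, `i(C) ∈ ℕ`, over the irreducible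
components `C` of `Y₁ ∩ Y₂`.** If the closed analytic `Y₁, Y₂ ⊆ X` (pure dimensions `d₁, d₂`) meet
PROPERLY — `Y₁ ∩ Y₂` has the expected pure dimension `q + 1 = d₁ + d₂ − dim X ≥ 1` — then the
intersection cycle `S` of §2 is supported on `Y₁ ∩ Y₂` and its components, irreducible analytic of the
full dimension `q + 1`, are irreducible components of `Y₁ ∩ Y₂`
(`isIrreducibleComponent_of_subset_of_hasPureDim`); so there are integers `i(C) ≥ 0`, zero off the
(finitely many, `finite_isIrreducibleComponent`) irreducible components `C` of `Y₁ ∩ Y₂`, with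
`[Y₁] ∧ [Y₂] = sign(e) · Σ_C i(C) cl(C)`. Fulton: `Y₁ · Y₂ = Σ i(C; Y₁ · Y₂) [C]`; the positivity
`i(C) ≥ 1` (Prop. 7.1 (a)) is not asserted here. [cite: Fulton1998, §7.1 Prop. 7.1, §8.2 and §11.1 Cor. 11.1]
[cite: Chirka1989, §12.3 and §16.1 Prop. 1] [cite: Lange2023AbelianVarietiesComplex, §7.3.1] -/
theorem exists_wedge_analyticCycleClass_eq_sum_isIrreducibleComponent (hk₁ : 2 * d₁ + 2 * p₁ = n)
    (hk₂ : 2 * d₂ + 2 * p₂ = n) (hq : 2 * (q + 1) + 2 * (p₁ + p₂) = n) {Y₁ Y₂ : Set (ComplexTorus Φ)}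
    (hY₁ : HasPureDim 𝓘(ℂ, E) Y₁ d₁) (hY₂ : HasPureDim 𝓘(ℂ, E) Y₂ d₂)
    (hI : HasPureDim 𝓘(ℂ, E) (Y₁ ∩ Y₂) (q + 1)) :
    ∃ i : Set (ComplexTorus Φ) → ℤ, (∀ C, 0 ≤ i C) ∧
      (∀ C, i C ≠ 0 → IsIrreducibleComponent 𝓘(ℂ, E) (Y₁ ∩ Y₂) C) ∧
        ((analyticCycleClass Φ e hk₁ hY₁).wedge (analyticCycleClass Φ e hk₂ hY₂)).domDomCongr
            (finCongr (by ring : 2 * p₁ + 2 * p₂ = 2 * (p₁ + p₂))) =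
          (orientationSign Φ e : ℂ) •
            ∑ C ∈ (finite_isIrreducibleComponent Φ hI.isAnalyticSet).toFinset, i C • setCycleClass Φ e hq C := by
  obtain ⟨S, hS0, hsupp, hcl⟩ := exists_effectiveCycle_wedge_analyticCycleClass_eq Φ e hk₁ hk₂ hq hY₁ hY₂
  have hcomp : ∀ C, S.mult C ≠ 0 → IsIrreducibleComponent 𝓘(ℂ, E) (Y₁ ∩ Y₂) C := fun C hC ↦
    isIrreducibleComponent_of_subset_of_hasPureDim hI (S.isIrreducibleAnalyticSet_of_mult_ne_zero hC)
      (S.hasPureDim_of_mult_ne_zero hC) ((HolomorphicChain.subset_support hC).trans hsupp)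
  refine ⟨S.mult, hS0, hcomp, ?_⟩
  rw [hcl, chainCycleClass_eq_sum_of_subset Φ e hq S]
  intro C hC
  exact (finite_isIrreducibleComponent Φ hI.isAnalyticSet).mem_toFinset.2
    (hcomp C (HolomorphicChain.mem_components_iff.1 hC))

open Classical in
/-- **An irreducible proper intersection: `[Y₁]_e ∧ [Y₂]_e = sign(e) · m · [Y₁ ∩ Y₂]_e` with `m ∈ ℕ`**
(the intersection multiplicity of the unique component; `m ≥ 1` iff `[Y₁] ∧ [Y₂] ≠ 0`, its positivity in
general not being asserted here). [cite: Fulton1998, §7.1 Prop. 7.1 and §8.2] [cite: Chirka1989, §12.3] -/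
theorem exists_wedge_analyticCycleClass_eq_natCast_smul_of_isIrreducible (hk₁ : 2 * d₁ + 2 * p₁ = n)
    (hk₂ : 2 * d₂ + 2 * p₂ = n) (hq : 2 * (q + 1) + 2 * (p₁ + p₂) = n) {Y₁ Y₂ : Set (ComplexTorus Φ)}
    (hY₁ : HasPureDim 𝓘(ℂ, E) Y₁ d₁) (hY₂ : HasPureDim 𝓘(ℂ, E) Y₂ d₂)
    (hI : HasPureDim 𝓘(ℂ, E) (Y₁ ∩ Y₂) (q + 1)) (hirr : IsIrreducibleAnalyticSet 𝓘(ℂ, E) (Y₁ ∩ Y₂)) :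
    ∃ m : ℕ,
      ((analyticCycleClass Φ e hk₁ hY₁).wedge (analyticCycleClass Φ e hk₂ hY₂)).domDomCongr
          (finCongr (by ring : 2 * p₁ + 2 * p₂ = 2 * (p₁ + p₂))) =
        (orientationSign Φ e : ℂ) • ((m : ℂ) • analyticCycleClass Φ e hq hI) := by
  obtain ⟨S, hS0, hsupp, hcl⟩ := exists_effectiveCycle_wedge_analyticCycleClass_eq Φ e hk₁ hk₂ hq hY₁ hY₂
  -- every component of `S` is the irreducible set `Y₁ ∩ Y₂` itself
  have hcomp : ∀ C, S.mult C ≠ 0 → C = Y₁ ∩ Y₂ := fun C hC ↦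
    (hirr.isIrreducibleComponent_iff.1
      (isIrreducibleComponent_of_subset_of_hasPureDim hI (S.isIrreducibleAnalyticSet_of_mult_ne_zero hC)
        (S.hasPureDim_of_mult_ne_zero hC) ((HolomorphicChain.subset_support hC).trans hsupp)))
  have hsub : S.components ⊆ ({Y₁ ∩ Y₂} : Finset (Set (ComplexTorus Φ))) := fun C hC ↦
    Finset.mem_singleton.2 (hcomp C (HolomorphicChain.mem_components_iff.1 hC))
  refine ⟨(S.mult (Y₁ ∩ Y₂)).toNat, ?_⟩
  rw [hcl, chainCycleClass_eq_sum_of_subset Φ e hq S hsub, Finset.sum_singleton,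
    setCycleClass_of_hasPureDim Φ e hq hI]
  congr 1
  rw [Nat.cast_smul_eq_nsmul ℂ, ← natCast_zsmul, Int.toNat_of_nonneg (hS0 _)]

/-! ### §5 Numerical positivity: `deg(Y₁ · Y₂) ≥ 0`, with equality iff `[Y₁] ∧ [Y₂] = 0` -/

open Classical in
/-- **`deg(Y₁ · Y₂) = Re ⟨ω^{q+1}/(q+1)!, sign(e) [Y₁]_e ∧ [Y₂]_e⟩ ≥ 0`**: the product of the classes of two
closed analytic subsets (expected dimension `q + 1 ≥ 1`) has non-negative degree against the flat Kähler
form — it is the degree `Σ m_ν vol(W_ν)` of the effective intersection cycle (Wirtinger). Fulton, §12.2: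
on a variety whose tangent bundle is generated by its sections (Example 12.2.1 (a): abelian varieties)
every intersection product of subvarieties is represented by a non-negative cycle.
[cite: Fulton1998, §12.2 Cor. 12.2 (a) and Example 12.2.1 (a)] [cite: VoisinHodgeI2002, §3.1.3 (Wirtinger)]
[cite: Chirka1989, §13.3 Cor.] -/
theorem re_poincarePairing_kaehlerPow_smul_wedge_nonneg (hk₁ : 2 * d₁ + 2 * p₁ = n)
    (hk₂ : 2 * d₂ + 2 * p₂ = n) (hq : 2 * (q + 1) + 2 * (p₁ + p₂) = n) {Y₁ Y₂ : Set (ComplexTorus Φ)}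
    (hY₁ : HasPureDim 𝓘(ℂ, E) Y₁ d₁) (hY₂ : HasPureDim 𝓘(ℂ, E) Y₂ d₂) :
    0 ≤ (poincarePairing Φ e hq (ofRealCLM.compContinuousAlternatingMap (kaehlerPow (q + 1)))
      ((orientationSign Φ e : ℂ) •
        ((analyticCycleClass Φ e hk₁ hY₁).wedge (analyticCycleClass Φ e hk₂ hY₂)).domDomCongr
          (finCongr (by ring : 2 * p₁ + 2 * p₂ = 2 * (p₁ + p₂))))).re := by
  have hs : ((orientationSign Φ e : ℤ) : ℂ) * orientationSign Φ e = 1 := by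
    exact_mod_cast orientationSign_mul_self Φ e
  obtain ⟨S, hS0, -, hcl⟩ := exists_effectiveCycle_wedge_analyticCycleClass_eq Φ e hk₁ hk₂ hq hY₁ hY₂
  rw [hcl, smul_smul, hs, one_smul, re_poincarePairing_kaehlerPow_chainCycleClass_eq_sum]
  exact Finset.sum_nonneg fun Z _ ↦ mult_mul_re_poincarePairing_kaehlerPow_nonneg Φ e hq hS0 Z

open Classical in
/-- **`deg(Y₁ · Y₂) > 0` iff `[Y₁] ∧ [Y₂] ≠ 0`**: a non-zero product of classes of closed analytic subsets
(expected dimension `q + 1 ≥ 1`) has POSITIVE degree (a component of the intersection cycle has positive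
volume, `vol(W) ≤ deg S`). [cite: Fulton1998, §12.2 Cor. 12.2 (a)–(b) and Example 12.2.1 (a)]
[cite: VoisinHodgeI2002, §3.1.3 (Wirtinger)] [cite: Chirka1989, §13.3 Cor. and §15.3 Thm.] -/
theorem re_poincarePairing_kaehlerPow_smul_wedge_pos_iff (hk₁ : 2 * d₁ + 2 * p₁ = n)
    (hk₂ : 2 * d₂ + 2 * p₂ = n) (hq : 2 * (q + 1) + 2 * (p₁ + p₂) = n) {Y₁ Y₂ : Set (ComplexTorus Φ)}
    (hY₁ : HasPureDim 𝓘(ℂ, E) Y₁ d₁) (hY₂ : HasPureDim 𝓘(ℂ, E) Y₂ d₂) :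
    0 < (poincarePairing Φ e hq (ofRealCLM.compContinuousAlternatingMap (kaehlerPow (q + 1)))
      ((orientationSign Φ e : ℂ) •
        ((analyticCycleClass Φ e hk₁ hY₁).wedge (analyticCycleClass Φ e hk₂ hY₂)).domDomCongr
          (finCongr (by ring : 2 * p₁ + 2 * p₂ = 2 * (p₁ + p₂))))).re ↔
      (analyticCycleClass Φ e hk₁ hY₁).wedge (analyticCycleClass Φ e hk₂ hY₂) ≠ 0 := by
  have hs : ((orientationSign Φ e : ℤ) : ℂ) * orientationSign Φ e = 1 := by
    exact_mod_cast orientationSign_mul_self Φ e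
  obtain ⟨S, hS0, -, hcl⟩ := exists_effectiveCycle_wedge_analyticCycleClass_eq Φ e hk₁ hk₂ hq hY₁ hY₂
  rw [hcl, smul_smul, hs, one_smul]
  constructor
  · intro hpos h0
    rw [h0, domDomCongr_finCongr_zero] at hcl
    -- `cl(S) = 0`
    have hclS : chainCycleClass Φ e hq S = 0 := by
      have h := congrArg ((orientationSign Φ e : ℂ) • ·) hcl
      simp only [smul_smul, hs, one_smul] at h
      rw [smul_zero] at h
      exact h.symm
    rw [hclS, map_zero, Complex.zero_re] at hpos
    exact lt_irrefl _ hpos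
  · intro hne
    -- `S` has a component, of positive volume `≤ deg S`
    have hS : S.components.Nonempty := by
      by_contra hempty
      apply hne
      have hsub : S.components ⊆ (∅ : Finset (Set (ComplexTorus Φ))) := by
        rw [Set.not_nonempty_iff_eq_empty.1 hempty]; simp
      have h := hcl
      rw [chainCycleClass_eq_sum_of_subset Φ e hq S hsub, Finset.sum_empty, smul_zero,
        domDomCongr_finCongr_eq_zero_iff] at h
      exact h
    obtain ⟨Z, hZ⟩ := hS
    have hZ0 : S.mult Z ≠ 0 := HolomorphicChain.mem_components_iff.1 hZ
    refine lt_of_lt_of_le ?_ (volume_le_degree_of_mem_components Φ e hq hS0 hZ0)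
    exact ENNReal.toReal_pos (measure_periodBox_inter_carrier_pos Φ (S.hasPureDim_of_mult_ne_zero hZ0) 0).ne'
      (measure_periodBox_inter_carrier_lt_top Φ (S.hasPureDim_of_mult_ne_zero hZ0) 0).ne

/-! ### §6 Positivity of the intersection multiplicities: `|S| = Y₁ ∩ Y₂` and `i(C) ≥ 1` for proper intersections -/

open Classical in
/-- **THE INTERSECTION CYCLE OF A PROPER INTERSECTION IS SUPPORTED ON ALL OF `Y₁ ∩ Y₂`.** If the closed
analytic `Y₁, Y₂ ⊆ X` (pure dimensions `d₁, d₂`) meet properly — `Y₁ ∩ Y₂` has the expected pure dimension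
`q + 1 = d₁ + d₂ − dim X ≥ 1` — there is an EFFECTIVE holomorphic `(q+1)`-chain `S` with `|S| = Y₁ ∩ Y₂`
(not only `⊆`) and `[Y₁]_e ∧ [Y₂]_e = sign(e) · cl_e(S)`. As in §2, `S` is Bishop's limit of the cycles
`[Y₁ ∩ (Y₂ − t_j)]` along generic `t_j → 0` (for `t` near `0` these are non-empty, hence of pure dimension
`q + 1` by Kleiman (a), `ae_inter_translate_eq_empty_or_hasPureDim`), and `|S|` is their limit set; by
Remmert's open mapping theorem for `(x, y) ↦ y − x` on `Y₁ × Y₂`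
(`mem_closure_iUnion_inter_preimage_add_of_hasPureDim`) every point of the proper intersection `Y₁ ∩ Y₂`
belongs to that limit set. Fulton: the limit cycle of a proper intersection is `Σ i(C) [C]` over ALL its
components, `i(C) ≥ 1`. [cite: Fulton1998, §7.1 Prop. 7.1 (a), §11.1 Cor. 11.1 and Example 11.4.5]
[cite: Fischer1976, §3.9 Prop.] [cite: Chirka1989, §16.1 Prop. 1 and §12.3] -/
theorem exists_effectiveCycle_wedge_analyticCycleClass_eq_support_eq (hk₁ : 2 * d₁ + 2 * p₁ = n)
    (hk₂ : 2 * d₂ + 2 * p₂ = n) (hq : 2 * (q + 1) + 2 * (p₁ + p₂) = n) {Y₁ Y₂ : Set (ComplexTorus Φ)}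
    (hY₁ : HasPureDim 𝓘(ℂ, E) Y₁ d₁) (hY₂ : HasPureDim 𝓘(ℂ, E) Y₂ d₂)
    (hI : HasPureDim 𝓘(ℂ, E) (Y₁ ∩ Y₂) (q + 1)) :
    ∃ S : HolomorphicChain 𝓘(ℂ, E) (ComplexTorus Φ) (q + 1),
      (∀ W, 0 ≤ S.mult W) ∧ S.support = Y₁ ∩ Y₂ ∧
        ((analyticCycleClass Φ e hk₁ hY₁).wedge (analyticCycleClass Φ e hk₂ hY₂)).domDomCongr
            (finCongr (by ring : 2 * p₁ + 2 * p₂ = 2 * (p₁ + p₂))) =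
          (orientationSign Φ e : ℂ) • chainCycleClass Φ e hq S := by
  have hs : ((orientationSign Φ e : ℤ) : ℂ) * orientationSign Φ e = 1 := by
    exact_mod_cast orientationSign_mul_self Φ e
  have hng : finrank ℂ E * 2 = n := finrank_complex_mul_two Φ e
  have hr : (q + 1) + finrank ℂ E = d₁ + d₂ := by omega
  have hdim : d₁ + d₂ = (q + 1) + finrank ℂ E := hr.symm
  -- generic translates `Y₁ ∩ (Y₂ - t)`: empty or of pure dimension `q + 1`, with the class `sign(e) [Y₁] ∧ [Y₂]`
  have hep := ae_inter_translate_eq_empty_or_hasPureDim Φ hdim hY₁ hY₂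
  have hcl := ae_wedge_analyticCycleClass_eq_smul_setCycleClass_inter_translate Φ e hk₁ hk₂ hq
    (Nat.succ_pos q) hY₁ hY₂
  -- small translates are non-empty (a point of the proper intersection persists, Remmert)
  obtain ⟨z₀, hz₀⟩ := hI.nonempty
  have hne : ∀ᶠ t in 𝓝 (0 : ComplexTorus Φ), (Y₁ ∩ (fun x ↦ x + t) ⁻¹' Y₂).Nonempty := by
    have h := eventually_nonempty_inter_preimage_add_of_hasPureDim Φ hY₁ hY₂ hr hI hz₀ univ_mem
    simpa only [univ_inter] using h
  obtain ⟨N₀, hN₀, hN₀o, h0N₀⟩ := _root_.mem_nhds_iff.1 hne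
  -- a full-measure set is dense: pick generic non-empty translates `t j → 0`
  have hdense := Measure.dense_of_ae (hep.and hcl)
  have h0 := hdense.open_subset_closure_inter hN₀o h0N₀
  obtain ⟨t, htG, ht0⟩ := mem_closure_iff_seq_limit.1 h0
  have hZ : ∀ j, HasPureDim 𝓘(ℂ, E) (Y₁ ∩ (fun x ↦ x + t j) ⁻¹' Y₂) (q + 1) := fun j ↦
    (htG j).2.1.resolve_left (hN₀ (htG j).1).ne_empty
  have hclass : ∀ j, analyticCycleClass Φ e hq (hZ j) =
      (orientationSign Φ e : ℂ) •
        ((analyticCycleClass Φ e hk₁ hY₁).wedge (analyticCycleClass Φ e hk₂ hY₂)).domDomCongr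
          (finCongr (by ring : 2 * p₁ + 2 * p₂ = 2 * (p₁ + p₂))) := by
    intro j
    have h := (htG j).2.2
    rw [setCycleClass_of_hasPureDim Φ e hq (hZ j)] at h
    rw [h, smul_smul, hs, one_smul]
  -- uniform volume bound: by Wirtinger every `Y₁ ∩ (Y₂ - t j)` has the volume of the common class
  obtain ⟨V, hV⟩ : ∃ V : ℝ, ∀ j,
      (μHE[2 * (q + 1)] : Measure E).real (periodBox Φ 0 ∩ (analyticChain Φ (hZ j)).carrier) = V := by
    refine ⟨(poincarePairing Φ e hq (ofRealCLM.compContinuousAlternatingMap (kaehlerPow (q + 1)))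
      ((orientationSign Φ e : ℂ) •
        ((analyticCycleClass Φ e hk₁ hY₁).wedge (analyticCycleClass Φ e hk₂ hY₂)).domDomCongr
          (finCongr (by ring : 2 * p₁ + 2 * p₂ = 2 * (p₁ + p₂))))).re, fun j ↦ ?_⟩
    have h := poincarePairing_kaehlerPow_analyticCycleClass Φ e hq (hZ j)
    rw [hclass j] at h
    rw [h, Complex.ofReal_re]
  have hvol : ∀ j, (μHE[2 * (q + 1)] : Measure E)
      (cover Φ ⁻¹' (Y₁ ∩ (fun x ↦ x + t j) ⁻¹' Y₂) ∩ periodBox Φ 0) ≤ ENNReal.ofReal V := by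
    intro j
    have heq : (μHE[2 * (q + 1)] : Measure E) (cover Φ ⁻¹' (Y₁ ∩ (fun x ↦ x + t j) ⁻¹' Y₂) ∩ periodBox Φ 0) =
        (μHE[2 * (q + 1)] : Measure E) (periodBox Φ 0 ∩ (analyticChain Φ (hZ j)).carrier) := by
      rw [← image_val_liftSet, analyticChain,
        HolomorphicChain.measure_image_inter_eq_carrier_inter (hasPureDim_liftSet Φ (hZ j)), inter_comm]
    rw [heq, ← ENNReal.ofReal_toReal (measure_periodBox_inter_carrier_lt_top Φ (hZ j) 0).ne, ← measureReal_def,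
      hV j]
  -- Bishop: a subsequence converges to an effective cycle with the same class, supported on the limit set
  obtain ⟨κ, S, hκ, hS0, -, hsupp, hclS, -⟩ :=
    exists_subseq_effectiveCycle_of_measure_le Φ hZ e hq ENNReal.ofReal_lt_top hvol
  refine ⟨S, hS0, Subset.antisymm (fun z hz ↦ ?_) (fun z hz ↦ ?_), ?_⟩
  · -- `|S| ⊆ Y₁ ∩ Y₂` as in §2
    have hz' := (hsupp z).1 hz
    refine ⟨?_, ?_⟩
    · have h1 : closure (⋃ j ≥ (0 : ℕ), Y₁ ∩ (fun x ↦ x + t (κ j)) ⁻¹' Y₂) ⊆ Y₁ :=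
        closure_minimal (iUnion₂_subset fun j _ ↦ inter_subset_left) hY₁.isAnalyticSet.isClosed
      exact h1 (hz' 0)
    · refine mem_of_forall_mem_closure_iUnion_translate Φ hY₂.isAnalyticSet.isClosed
        (ht0.comp hκ.tendsto_atTop) fun N ↦ ?_
      exact closure_mono (iUnion₂_mono fun j _ ↦ inter_subset_right) (hz' N)
  · -- `Y₁ ∩ Y₂ ⊆ |S|`: every point of the proper intersection is a limit point of the translates (Remmert)
    exact (hsupp z).2 fun N ↦
      mem_closure_iUnion_inter_preimage_add_of_hasPureDim Φ hY₁ hY₂ hr hI hz (ht0.comp hκ.tendsto_atTop) N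
  · obtain ⟨j, hj⟩ := hclS.exists
    rw [← hj, hclass, smul_smul, hs, one_smul]

open Classical in
/-- **`[Y₁]_e ∧ [Y₂]_e = sign(e) · Σ_C i(C) cl_e(C)` with `1 ≤ i(C)` for EVERY irreducible component `C` of a
proper intersection `Y₁ ∩ Y₂`** — Fulton's `Y₁ · Y₂ = Σ i(C; Y₁ · Y₂) [C]` with the POSITIVITY of the
intersection multiplicities of the proper components ([Fulton1998, §7.1 Prop. 7.1 (a)]: "`1 ≤ i(β)`").
The multiplicity `i(C) = m_C` is the multiplicity of `C` in the intersection cycle `S` of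
`exists_effectiveCycle_wedge_analyticCycleClass_eq_support_eq`: an irreducible component `C` of
`Y₁ ∩ Y₂ = |S| = ⋃ W_ν` lies in some component `W_ν` of `S` (irreducibility), itself an irreducible analytic
subset of `Y₁ ∩ Y₂` of full dimension, so `C = W_ν` and `m_C ≠ 0`, `m_C ≥ 1`.
[cite: Fulton1998, §7.1 Prop. 7.1 (a), §8.2 and §11.1 Cor. 11.1] [cite: Chirka1989, §12.3 and §16.1 Prop. 1]
[cite: Lange2023AbelianVarietiesComplex, §7.3.1] -/
theorem exists_wedge_analyticCycleClass_eq_sum_isIrreducibleComponent_pos (hk₁ : 2 * d₁ + 2 * p₁ = n)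
    (hk₂ : 2 * d₂ + 2 * p₂ = n) (hq : 2 * (q + 1) + 2 * (p₁ + p₂) = n) {Y₁ Y₂ : Set (ComplexTorus Φ)}
    (hY₁ : HasPureDim 𝓘(ℂ, E) Y₁ d₁) (hY₂ : HasPureDim 𝓘(ℂ, E) Y₂ d₂)
    (hI : HasPureDim 𝓘(ℂ, E) (Y₁ ∩ Y₂) (q + 1)) :
    ∃ i : Set (ComplexTorus Φ) → ℤ,
      (∀ C, IsIrreducibleComponent 𝓘(ℂ, E) (Y₁ ∩ Y₂) C → 1 ≤ i C) ∧
      (∀ C, i C ≠ 0 → IsIrreducibleComponent 𝓘(ℂ, E) (Y₁ ∩ Y₂) C) ∧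
        ((analyticCycleClass Φ e hk₁ hY₁).wedge (analyticCycleClass Φ e hk₂ hY₂)).domDomCongr
            (finCongr (by ring : 2 * p₁ + 2 * p₂ = 2 * (p₁ + p₂))) =
          (orientationSign Φ e : ℂ) •
            ∑ C ∈ (finite_isIrreducibleComponent Φ hI.isAnalyticSet).toFinset, i C • setCycleClass Φ e hq C := by
  obtain ⟨S, hS0, hsupp, hcl⟩ :=
    exists_effectiveCycle_wedge_analyticCycleClass_eq_support_eq Φ e hk₁ hk₂ hq hY₁ hY₂ hI
  have hcomp : ∀ C, S.mult C ≠ 0 → IsIrreducibleComponent 𝓘(ℂ, E) (Y₁ ∩ Y₂) C := fun C hC ↦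
    isIrreducibleComponent_of_subset_of_hasPureDim hI (S.isIrreducibleAnalyticSet_of_mult_ne_zero hC)
      (S.hasPureDim_of_mult_ne_zero hC) ((HolomorphicChain.subset_support hC).trans hsupp.le)
  -- every irreducible component of `Y₁ ∩ Y₂ = |S|` is a component of `S`
  have hpos : ∀ C, IsIrreducibleComponent 𝓘(ℂ, E) (Y₁ ∩ Y₂) C → 1 ≤ S.mult C := by
    intro C hC
    have hCsub : C ⊆ ⋃ W ∈ S.finite_components_of_compactSpace.toFinset, W := by
      intro x hx
      have hx' : x ∈ S.support := by rw [hsupp]; exact hC.subset hx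
      obtain ⟨W, hW0, hxW⟩ := HolomorphicChain.mem_support_iff.1 hx'
      exact mem_iUnion₂.2 ⟨W, S.finite_components_of_compactSpace.mem_toFinset.2 hW0, hxW⟩
    obtain ⟨W, hW, hCW⟩ := hC.isIrreducibleAnalyticSet.exists_subset_of_subset_biUnion
      S.finite_components_of_compactSpace.toFinset
      (fun W hW ↦ (S.isIrreducibleAnalyticSet_of_mult_ne_zero
        (S.finite_components_of_compactSpace.mem_toFinset.1 hW)).1) hCsub
    have hW0 : S.mult W ≠ 0 := S.finite_components_of_compactSpace.mem_toFinset.1 hW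
    have hWC : W = C := hC.eq_of_subset (S.isIrreducibleAnalyticSet_of_mult_ne_zero hW0) hCW
      ((HolomorphicChain.subset_support hW0).trans hsupp.le)
    rw [← hWC]
    have h0 := hS0 W
    omega
  refine ⟨S.mult, hpos, hcomp, ?_⟩
  rw [hcl, chainCycleClass_eq_sum_of_subset Φ e hq S]
  intro C hC
  exact (finite_isIrreducibleComponent Φ hI.isAnalyticSet).mem_toFinset.2
    (hcomp C (HolomorphicChain.mem_components_iff.1 hC))

open Classical in
/-- **An irreducible proper intersection: `[Y₁]_e ∧ [Y₂]_e = sign(e) · (m + 1) · [Y₁ ∩ Y₂]_e`, `m ∈ ℕ`** — the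
intersection multiplicity of the unique proper component is POSITIVE ([Fulton1998, §7.1 Prop. 7.1 (a)]).
[cite: Fulton1998, §7.1 Prop. 7.1 (a) and §8.2] [cite: Chirka1989, §12.3] -/
theorem exists_wedge_analyticCycleClass_eq_succ_smul_of_isIrreducible (hk₁ : 2 * d₁ + 2 * p₁ = n)
    (hk₂ : 2 * d₂ + 2 * p₂ = n) (hq : 2 * (q + 1) + 2 * (p₁ + p₂) = n) {Y₁ Y₂ : Set (ComplexTorus Φ)}
    (hY₁ : HasPureDim 𝓘(ℂ, E) Y₁ d₁) (hY₂ : HasPureDim 𝓘(ℂ, E) Y₂ d₂)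
    (hI : HasPureDim 𝓘(ℂ, E) (Y₁ ∩ Y₂) (q + 1)) (hirr : IsIrreducibleAnalyticSet 𝓘(ℂ, E) (Y₁ ∩ Y₂)) :
    ∃ m : ℕ,
      ((analyticCycleClass Φ e hk₁ hY₁).wedge (analyticCycleClass Φ e hk₂ hY₂)).domDomCongr
          (finCongr (by ring : 2 * p₁ + 2 * p₂ = 2 * (p₁ + p₂))) =
        (orientationSign Φ e : ℂ) • (((m + 1 : ℕ) : ℂ) • analyticCycleClass Φ e hq hI) := by
  obtain ⟨i, hpos, hcomp, hcl⟩ :=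
    exists_wedge_analyticCycleClass_eq_sum_isIrreducibleComponent_pos Φ e hk₁ hk₂ hq hY₁ hY₂ hI
  have hself : IsIrreducibleComponent 𝓘(ℂ, E) (Y₁ ∩ Y₂) (Y₁ ∩ Y₂) := hirr.isIrreducibleComponent_self
  -- the only irreducible component is `Y₁ ∩ Y₂`
  have huniq : ∀ C, IsIrreducibleComponent 𝓘(ℂ, E) (Y₁ ∩ Y₂) C → C = Y₁ ∩ Y₂ := fun C hC ↦
    hirr.isIrreducibleComponent_iff.1 hC
  have hfs : (finite_isIrreducibleComponent Φ hI.isAnalyticSet).toFinset = {Y₁ ∩ Y₂} := by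
    ext C
    rw [Set.Finite.mem_toFinset, Finset.mem_singleton, mem_setOf_eq]
    exact ⟨fun h ↦ huniq C h, fun h ↦ h ▸ hself⟩
  have h1 := hpos _ hself
  refine ⟨(i (Y₁ ∩ Y₂)).toNat - 1, ?_⟩
  rw [hcl, hfs, Finset.sum_singleton, setCycleClass_of_hasPureDim Φ e hq hI]
  congr 1
  have hnat : ((i (Y₁ ∩ Y₂)).toNat - 1 + 1 : ℕ) = (i (Y₁ ∩ Y₂)).toNat := by omega
  rw [hnat, Nat.cast_smul_eq_nsmul ℂ, ← natCast_zsmul, Int.toNat_of_nonneg (by omega)]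

open Classical in
/-- **A non-empty proper intersection is homologically non-trivial: `[Y₁] ∧ [Y₂] ≠ 0`** (the intersection
cycle is a non-zero effective cycle, whose class is non-zero by Wirtinger / §5).
[cite: Fulton1998, §7.1 Prop. 7.1 (a) and §12.2 Cor. 12.2 (a)] [cite: Chirka1989, §13.3 Cor.] -/
theorem wedge_analyticCycleClass_ne_zero_of_hasPureDim_inter (hk₁ : 2 * d₁ + 2 * p₁ = n)
    (hk₂ : 2 * d₂ + 2 * p₂ = n) (hq : 2 * (q + 1) + 2 * (p₁ + p₂) = n) {Y₁ Y₂ : Set (ComplexTorus Φ)}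
    (hY₁ : HasPureDim 𝓘(ℂ, E) Y₁ d₁) (hY₂ : HasPureDim 𝓘(ℂ, E) Y₂ d₂)
    (hI : HasPureDim 𝓘(ℂ, E) (Y₁ ∩ Y₂) (q + 1)) :
    (analyticCycleClass Φ e hk₁ hY₁).wedge (analyticCycleClass Φ e hk₂ hY₂) ≠ 0 := by
  have hs : ((orientationSign Φ e : ℤ) : ℂ) * orientationSign Φ e = 1 := by
    exact_mod_cast orientationSign_mul_self Φ e
  obtain ⟨S, hS0, hsupp, hcl⟩ :=
    exists_effectiveCycle_wedge_analyticCycleClass_eq_support_eq Φ e hk₁ hk₂ hq hY₁ hY₂ hI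
  -- `S` has a component (its support `Y₁ ∩ Y₂` is non-empty), of positive volume `≤ deg S`
  obtain ⟨z, hz⟩ := hI.nonempty
  rw [← hsupp] at hz
  obtain ⟨Z, hZ0, -⟩ := HolomorphicChain.mem_support_iff.1 hz
  intro h0
  rw [h0, domDomCongr_finCongr_zero] at hcl
  have hclS : chainCycleClass Φ e hq S = 0 := by
    have h := congrArg ((orientationSign Φ e : ℂ) • ·) hcl
    simp only [smul_smul, hs, one_smul] at h
    rw [smul_zero] at h
    exact h.symm
  have hle := volume_le_degree_of_mem_components Φ e hq hS0 hZ0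
  rw [hclS, map_zero, Complex.zero_re, measureReal_def] at hle
  have hpos := ENNReal.toReal_pos (measure_periodBox_inter_carrier_pos Φ (S.hasPureDim_of_mult_ne_zero hZ0) 0).ne'
    (measure_periodBox_inter_carrier_lt_top Φ (S.hasPureDim_of_mult_ne_zero hZ0) 0).ne
  exact absurd hle (not_le.2 hpos)

open Classical in
/-- **`deg(Y₁ · Y₂) > 0` for a non-empty proper intersection.** [cite: Fulton1998, §12.2 Cor. 12.2 (a)–(b) and
Example 12.2.1 (a); §7.1 Prop. 7.1 (a)] [cite: VoisinHodgeI2002, §3.1.3 (Wirtinger)] -/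
theorem re_poincarePairing_kaehlerPow_smul_wedge_pos_of_hasPureDim_inter (hk₁ : 2 * d₁ + 2 * p₁ = n)
    (hk₂ : 2 * d₂ + 2 * p₂ = n) (hq : 2 * (q + 1) + 2 * (p₁ + p₂) = n) {Y₁ Y₂ : Set (ComplexTorus Φ)}
    (hY₁ : HasPureDim 𝓘(ℂ, E) Y₁ d₁) (hY₂ : HasPureDim 𝓘(ℂ, E) Y₂ d₂)
    (hI : HasPureDim 𝓘(ℂ, E) (Y₁ ∩ Y₂) (q + 1)) :
    0 < (poincarePairing Φ e hq (ofRealCLM.compContinuousAlternatingMap (kaehlerPow (q + 1)))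
      ((orientationSign Φ e : ℂ) •
        ((analyticCycleClass Φ e hk₁ hY₁).wedge (analyticCycleClass Φ e hk₂ hY₂)).domDomCongr
          (finCongr (by ring : 2 * p₁ + 2 * p₂ = 2 * (p₁ + p₂))))).re :=
  (re_poincarePairing_kaehlerPow_smul_wedge_pos_iff Φ e hk₁ hk₂ hq hY₁ hY₂).2
    (wedge_analyticCycleClass_ne_zero_of_hasPureDim_inter Φ e hk₁ hk₂ hq hY₁ hY₂ hI)


/-! ### §7 Proper points of an arbitrary intersection lie in the support of the intersection cycle -/

open Classical in
/-- **One point of the expected dimension makes the intersection homologically non-trivial: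
`[Y₁] ∧ [Y₂] ≠ 0`.** If `z ∈ Y₁ ∩ Y₂` and `Y₁ ∩ Y₂` has dimension `≤ q + 1 = d₁ + d₂ − dim X` at `z` (all its
regular points near `z` have codimension `≥ dim X − (q + 1)`), then `[Y₁]_e ∧ [Y₂]_e ≠ 0`: by Remmert's open
mapping theorem the translates `Y₁ ∩ (Y₂ − t)` are non-empty for `t` near `0`
(`eventually_nonempty_inter_preimage_add`), a generic one is of pure dimension `q + 1` (Kleiman (a)) with
class `sign(e) [Y₁] ∧ [Y₂]` (moving lemma), and the class of a non-empty analytic subset is non-zero.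
[cite: Fulton1998, §7.1 Prop. 7.1 (a) and §11.1] [cite: Fischer1976, §3.9 Prop.]
[cite: Kleiman1974Transversality, Thm. 2] -/
theorem wedge_analyticCycleClass_ne_zero_of_codim_le (hk₁ : 2 * d₁ + 2 * p₁ = n) (hk₂ : 2 * d₂ + 2 * p₂ = n)
    (hq : 2 * (q + 1) + 2 * (p₁ + p₂) = n) {Y₁ Y₂ : Set (ComplexTorus Φ)}
    (hY₁ : HasPureDim 𝓘(ℂ, E) Y₁ d₁) (hY₂ : HasPureDim 𝓘(ℂ, E) Y₂ d₂) {z : ComplexTorus Φ} (hz : z ∈ Y₁ ∩ Y₂)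
    (hdim : ∀ᶠ x in 𝓝 z, x ∈ Y₁ ∩ Y₂ → ∀ c, IsRegularPointOfCodim 𝓘(ℂ, E) (Y₁ ∩ Y₂) c x →
      finrank ℂ E ≤ c + (q + 1)) :
    (analyticCycleClass Φ e hk₁ hY₁).wedge (analyticCycleClass Φ e hk₂ hY₂) ≠ 0 := by
  have hs : ((orientationSign Φ e : ℤ) : ℂ) * orientationSign Φ e = 1 := by
    exact_mod_cast orientationSign_mul_self Φ e
  have hng : finrank ℂ E * 2 = n := finrank_complex_mul_two Φ e
  have hr : (q + 1) + finrank ℂ E = d₁ + d₂ := by omega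
  have hep := ae_inter_translate_eq_empty_or_hasPureDim Φ hr.symm hY₁ hY₂
  have hcl := ae_wedge_analyticCycleClass_eq_smul_setCycleClass_inter_translate Φ e hk₁ hk₂ hq
    (Nat.succ_pos q) hY₁ hY₂
  -- small translates are non-empty near `z` (Remmert)
  have hne : ∀ᶠ t in 𝓝 (0 : ComplexTorus Φ), (Y₁ ∩ (fun x ↦ x + t) ⁻¹' Y₂).Nonempty := by
    have h := eventually_nonempty_inter_preimage_add Φ hY₁ hY₂ hr hz hdim univ_mem
    simpa only [univ_inter] using h
  obtain ⟨N₀, hN₀, hN₀o, h0N₀⟩ := _root_.mem_nhds_iff.1 hne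
  -- a generic small translate: non-empty, of pure dimension `q + 1`, with class `sign(e) [Y₁] ∧ [Y₂]`
  obtain ⟨t, htN, hte, htc⟩ := (Measure.dense_of_ae (hep.and hcl)).inter_open_nonempty N₀ hN₀o ⟨0, h0N₀⟩
  have hZt : HasPureDim 𝓘(ℂ, E) (Y₁ ∩ (fun x ↦ x + t) ⁻¹' Y₂) (q + 1) :=
    hte.resolve_left (hN₀ htN).ne_empty
  intro h0
  rw [h0, domDomCongr_finCongr_zero, setCycleClass_of_hasPureDim Φ e hq hZt] at htc
  have h1 := congrArg ((orientationSign Φ e : ℂ) • ·) htc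
  simp only [smul_smul, hs, one_smul, smul_zero] at h1
  exact analyticCycleClass_ne_zero Φ e hq hZt h1.symm

open Classical in
/-- **THE INTERSECTION CYCLE CONTAINS EVERY POINT OF `Y₁ ∩ Y₂` OF THE EXPECTED DIMENSION.** For closed
analytic `Y₁, Y₂ ⊆ X` of pure dimensions `d₁, d₂` (expected dimension `q + 1 ≥ 1`) there is an effective
`(q+1)`-cycle `S` with `|S| ⊆ Y₁ ∩ Y₂`, `[Y₁]_e ∧ [Y₂]_e = sign(e) · cl_e(S)`, and **`z ∈ |S|` for every
`z ∈ Y₁ ∩ Y₂` at which `Y₁ ∩ Y₂` has dimension `≤ q + 1`** (so every irreducible component of `Y₁ ∩ Y₂` of the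
expected dimension which is generically isolated from the excess components is a component of `S`; Fulton's
proper components). If there is no such point this is §2; otherwise `S` is the limit of generic NON-EMPTY small
translates (Remmert + Kleiman) as in §6, and the local form `mem_closure_iUnion_inter_preimage_add` puts every
proper point in the limit set. [cite: Fulton1998, §7.1 Prop. 7.1 (a), §11.1 Cor. 11.1 and Example 11.4.5]
[cite: Fischer1976, §3.9 Prop.] [cite: Chirka1989, §16.1 Prop. 1 and §12.3] -/
theorem exists_effectiveCycle_wedge_analyticCycleClass_eq_support_supset (hk₁ : 2 * d₁ + 2 * p₁ = n)
    (hk₂ : 2 * d₂ + 2 * p₂ = n) (hq : 2 * (q + 1) + 2 * (p₁ + p₂) = n) {Y₁ Y₂ : Set (ComplexTorus Φ)}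
    (hY₁ : HasPureDim 𝓘(ℂ, E) Y₁ d₁) (hY₂ : HasPureDim 𝓘(ℂ, E) Y₂ d₂) :
    ∃ S : HolomorphicChain 𝓘(ℂ, E) (ComplexTorus Φ) (q + 1),
      (∀ W, 0 ≤ S.mult W) ∧ S.support ⊆ Y₁ ∩ Y₂ ∧
        (∀ z ∈ Y₁ ∩ Y₂, (∀ᶠ x in 𝓝 z, x ∈ Y₁ ∩ Y₂ → ∀ c, IsRegularPointOfCodim 𝓘(ℂ, E) (Y₁ ∩ Y₂) c x →
          finrank ℂ E ≤ c + (q + 1)) → z ∈ S.support) ∧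
        ((analyticCycleClass Φ e hk₁ hY₁).wedge (analyticCycleClass Φ e hk₂ hY₂)).domDomCongr
            (finCongr (by ring : 2 * p₁ + 2 * p₂ = 2 * (p₁ + p₂))) =
          (orientationSign Φ e : ℂ) • chainCycleClass Φ e hq S := by
  have hs : ((orientationSign Φ e : ℤ) : ℂ) * orientationSign Φ e = 1 := by
    exact_mod_cast orientationSign_mul_self Φ e
  have hng : finrank ℂ E * 2 = n := finrank_complex_mul_two Φ e
  have hr : (q + 1) + finrank ℂ E = d₁ + d₂ := by omega
  by_cases hprop : ∃ z ∈ Y₁ ∩ Y₂, ∀ᶠ x in 𝓝 z, x ∈ Y₁ ∩ Y₂ → ∀ c,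
      IsRegularPointOfCodim 𝓘(ℂ, E) (Y₁ ∩ Y₂) c x → finrank ℂ E ≤ c + (q + 1)
  swap
  · -- no proper point: §2
    simp only [not_exists, not_and] at hprop
    obtain ⟨S, hS0, hsupp, hcl⟩ := exists_effectiveCycle_wedge_analyticCycleClass_eq Φ e hk₁ hk₂ hq hY₁ hY₂
    exact ⟨S, hS0, hsupp, fun z hz hdz ↦ absurd hdz (hprop z hz), hcl⟩
  obtain ⟨z₀, hz₀, hdim₀⟩ := hprop
  -- generic translates: empty or of pure dimension `q + 1`, with the class `sign(e) [Y₁] ∧ [Y₂]`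
  have hep := ae_inter_translate_eq_empty_or_hasPureDim Φ hr.symm hY₁ hY₂
  have hcl := ae_wedge_analyticCycleClass_eq_smul_setCycleClass_inter_translate Φ e hk₁ hk₂ hq
    (Nat.succ_pos q) hY₁ hY₂
  -- small translates are non-empty (the proper point `z₀` persists, Remmert)
  have hne : ∀ᶠ t in 𝓝 (0 : ComplexTorus Φ), (Y₁ ∩ (fun x ↦ x + t) ⁻¹' Y₂).Nonempty := by
    have h := eventually_nonempty_inter_preimage_add Φ hY₁ hY₂ hr hz₀ hdim₀ univ_mem
    simpa only [univ_inter] using h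
  obtain ⟨N₀, hN₀, hN₀o, h0N₀⟩ := _root_.mem_nhds_iff.1 hne
  have hdense := Measure.dense_of_ae (hep.and hcl)
  have h0 := hdense.open_subset_closure_inter hN₀o h0N₀
  obtain ⟨t, htG, ht0⟩ := mem_closure_iff_seq_limit.1 h0
  have hZ : ∀ j, HasPureDim 𝓘(ℂ, E) (Y₁ ∩ (fun x ↦ x + t j) ⁻¹' Y₂) (q + 1) := fun j ↦
    (htG j).2.1.resolve_left (hN₀ (htG j).1).ne_empty
  have hclass : ∀ j, analyticCycleClass Φ e hq (hZ j) =
      (orientationSign Φ e : ℂ) •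
        ((analyticCycleClass Φ e hk₁ hY₁).wedge (analyticCycleClass Φ e hk₂ hY₂)).domDomCongr
          (finCongr (by ring : 2 * p₁ + 2 * p₂ = 2 * (p₁ + p₂))) := by
    intro j
    have h := (htG j).2.2
    rw [setCycleClass_of_hasPureDim Φ e hq (hZ j)] at h
    rw [h, smul_smul, hs, one_smul]
  -- uniform volume bound (Wirtinger)
  obtain ⟨V, hV⟩ : ∃ V : ℝ, ∀ j,
      (μHE[2 * (q + 1)] : Measure E).real (periodBox Φ 0 ∩ (analyticChain Φ (hZ j)).carrier) = V := by
    refine ⟨(poincarePairing Φ e hq (ofRealCLM.compContinuousAlternatingMap (kaehlerPow (q + 1)))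
      ((orientationSign Φ e : ℂ) •
        ((analyticCycleClass Φ e hk₁ hY₁).wedge (analyticCycleClass Φ e hk₂ hY₂)).domDomCongr
          (finCongr (by ring : 2 * p₁ + 2 * p₂ = 2 * (p₁ + p₂))))).re, fun j ↦ ?_⟩
    have h := poincarePairing_kaehlerPow_analyticCycleClass Φ e hq (hZ j)
    rw [hclass j] at h
    rw [h, Complex.ofReal_re]
  have hvol : ∀ j, (μHE[2 * (q + 1)] : Measure E)
      (cover Φ ⁻¹' (Y₁ ∩ (fun x ↦ x + t j) ⁻¹' Y₂) ∩ periodBox Φ 0) ≤ ENNReal.ofReal V := by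
    intro j
    have heq : (μHE[2 * (q + 1)] : Measure E) (cover Φ ⁻¹' (Y₁ ∩ (fun x ↦ x + t j) ⁻¹' Y₂) ∩ periodBox Φ 0) =
        (μHE[2 * (q + 1)] : Measure E) (periodBox Φ 0 ∩ (analyticChain Φ (hZ j)).carrier) := by
      rw [← image_val_liftSet, analyticChain,
        HolomorphicChain.measure_image_inter_eq_carrier_inter (hasPureDim_liftSet Φ (hZ j)), inter_comm]
    rw [heq, ← ENNReal.ofReal_toReal (measure_periodBox_inter_carrier_lt_top Φ (hZ j) 0).ne, ← measureReal_def,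
      hV j]
  -- Bishop
  obtain ⟨κ, S, hκ, hS0, -, hsupp, hclS, -⟩ :=
    exists_subseq_effectiveCycle_of_measure_le Φ hZ e hq ENNReal.ofReal_lt_top hvol
  refine ⟨S, hS0, fun z hz ↦ ?_, fun z hz hdz ↦ ?_, ?_⟩
  · have hz' := (hsupp z).1 hz
    refine ⟨?_, ?_⟩
    · have h1 : closure (⋃ j ≥ (0 : ℕ), Y₁ ∩ (fun x ↦ x + t (κ j)) ⁻¹' Y₂) ⊆ Y₁ :=
        closure_minimal (iUnion₂_subset fun j _ ↦ inter_subset_left) hY₁.isAnalyticSet.isClosed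
      exact h1 (hz' 0)
    · refine mem_of_forall_mem_closure_iUnion_translate Φ hY₂.isAnalyticSet.isClosed
        (ht0.comp hκ.tendsto_atTop) fun N ↦ ?_
      exact closure_mono (iUnion₂_mono fun j _ ↦ inter_subset_right) (hz' N)
  · -- a proper point is a limit point of the translates (Remmert, local form)
    exact (hsupp z).2 fun N ↦
      mem_closure_iUnion_inter_preimage_add Φ hY₁ hY₂ hr hz hdz (ht0.comp hκ.tendsto_atTop) N
  · obtain ⟨j, hj⟩ := hclS.exists
    rw [← hj, hclass, smul_smul, hs, one_smul]


/-! ### §8 `[Y₁] ∧ [Y₂] ≠ 0` iff every translate of `Y₂` meets `Y₁` -/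

open scoped Pointwise

omit [Fintype ι] [DecidableEq ι] [FiniteDimensional ℂ E] [MeasurableSpace E] [BorelSpace E] in
/-- `Y − t` as a translate: `{x | x + t ∈ Y} = (−t) + Y`. [folklore] -/
private theorem preimage_add_right_eq_neg_vadd' (Y : Set (ComplexTorus Φ)) (t : ComplexTorus Φ) :
    (fun x ↦ x + t) ⁻¹' Y = (-t) +ᵥ Y := by
  ext x
  simp only [mem_preimage, Set.mem_vadd_set, vadd_eq_add]
  constructor
  · intro hx
    exact ⟨x + t, hx, by abel⟩
  · rintro ⟨y, hy, rfl⟩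
    rwa [show -t + y + t = y by abel]

open Classical in
/-- **`[Y₁] ∧ [Y₂] ≠ 0` IFF EVERY TRANSLATE OF `Y₂` MEETS `Y₁`** (expected dimension `q + 1 ≥ 1`). `⟹`: the class
of a translate is the class (`analyticCycleClass_vadd`), and a non-zero product forces a non-empty intersection
(§3). `⟸`: if all translates meet, the generic translate — empty or of the expected pure dimension by Kleiman (a),
`ae_inter_translate_eq_empty_or_hasPureDim` — is of pure dimension `q + 1`, so the product is non-zero by the
moving lemma (`wedge_analyticCycleClass_ne_zero_iff_ae_hasPureDim_inter_translate`).
[cite: Fulton1998, §11.1 Cor. 11.1 and Example 11.4.5, §12.2 Example 12.2.1 (a)]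
[cite: Kleiman1974Transversality, Thm. 2] [cite: Lange2023AbelianVarietiesComplex, §6.2.1 and Ex. 6.2.5 (1)] -/
theorem wedge_analyticCycleClass_ne_zero_iff_forall_inter_vadd_nonempty (hk₁ : 2 * d₁ + 2 * p₁ = n)
    (hk₂ : 2 * d₂ + 2 * p₂ = n) (hq : 2 * (q + 1) + 2 * (p₁ + p₂) = n) {Y₁ Y₂ : Set (ComplexTorus Φ)}
    (hY₁ : HasPureDim 𝓘(ℂ, E) Y₁ d₁) (hY₂ : HasPureDim 𝓘(ℂ, E) Y₂ d₂) :
    (analyticCycleClass Φ e hk₁ hY₁).wedge (analyticCycleClass Φ e hk₂ hY₂) ≠ 0 ↔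
      ∀ t : ComplexTorus Φ, (Y₁ ∩ (t +ᵥ Y₂)).Nonempty := by
  have hng : finrank ℂ E * 2 = n := finrank_complex_mul_two Φ e
  constructor
  · intro hne t
    have h := hne
    rw [← analyticCycleClass_vadd Φ e hk₂ hY₂ t] at h
    exact inter_nonempty_of_wedge_analyticCycleClass_ne_zero Φ e hk₁ hk₂ hq hY₁ (hasPureDim_vadd Φ hY₂ t) h
  · intro hall
    refine (wedge_analyticCycleClass_ne_zero_iff_ae_hasPureDim_inter_translate Φ e hk₁ hk₂ hq (Nat.succ_pos q)
      hY₁ hY₂).2 ?_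
    filter_upwards [ae_inter_translate_eq_empty_or_hasPureDim Φ (q := q + 1) (by omega) hY₁ hY₂] with t ht
    refine ht.resolve_left fun h0 ↦ ?_
    have h := hall (-t)
    rw [← preimage_add_right_eq_neg_vadd', h0] at h
    exact Set.not_nonempty_empty h

open Classical in
/-- **`[Y₁] ∧ [Y₂] = 0` iff `Y₂` can be translated off `Y₁`**: `∃ t, Y₁ ∩ (t + Y₂) = ∅`.
[cite: Fulton1998, §11.1 Cor. 11.1 and Example 11.4.5] [cite: Kleiman1974Transversality, Thm. 2] -/
theorem wedge_analyticCycleClass_eq_zero_iff_exists_inter_vadd_eq_empty (hk₁ : 2 * d₁ + 2 * p₁ = n)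
    (hk₂ : 2 * d₂ + 2 * p₂ = n) (hq : 2 * (q + 1) + 2 * (p₁ + p₂) = n) {Y₁ Y₂ : Set (ComplexTorus Φ)}
    (hY₁ : HasPureDim 𝓘(ℂ, E) Y₁ d₁) (hY₂ : HasPureDim 𝓘(ℂ, E) Y₂ d₂) :
    (analyticCycleClass Φ e hk₁ hY₁).wedge (analyticCycleClass Φ e hk₂ hY₂) = 0 ↔
      ∃ t : ComplexTorus Φ, Y₁ ∩ (t +ᵥ Y₂) = ∅ := by
  have h := wedge_analyticCycleClass_ne_zero_iff_forall_inter_vadd_nonempty Φ e hk₁ hk₂ hq hY₁ hY₂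
  constructor
  · intro h0
    by_contra hne
    simp only [not_exists] at hne
    exact (h.2 fun t ↦ Set.nonempty_iff_ne_empty.2 (hne t)) h0
  · rintro ⟨t, ht⟩
    by_contra hne
    exact (h.1 hne t).ne_empty ht

open Classical in
/-- **`[Y₁] ∧ [Y₂] ≠ 0` iff `Y₁ ∩ (Y₂ − t) ≠ ∅` for every `t`** (the translates written as `{x | x + t ∈ Y₂}`).
[cite: Fulton1998, §11.1 Cor. 11.1 and Example 11.4.5] [cite: Kleiman1974Transversality, Thm. 2] -/
theorem wedge_analyticCycleClass_ne_zero_iff_forall_inter_translate_nonempty (hk₁ : 2 * d₁ + 2 * p₁ = n)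
    (hk₂ : 2 * d₂ + 2 * p₂ = n) (hq : 2 * (q + 1) + 2 * (p₁ + p₂) = n) {Y₁ Y₂ : Set (ComplexTorus Φ)}
    (hY₁ : HasPureDim 𝓘(ℂ, E) Y₁ d₁) (hY₂ : HasPureDim 𝓘(ℂ, E) Y₂ d₂) :
    (analyticCycleClass Φ e hk₁ hY₁).wedge (analyticCycleClass Φ e hk₂ hY₂) ≠ 0 ↔
      ∀ t : ComplexTorus Φ, (Y₁ ∩ (fun x ↦ x + t) ⁻¹' Y₂).Nonempty := by
  rw [wedge_analyticCycleClass_ne_zero_iff_forall_inter_vadd_nonempty Φ e hk₁ hk₂ hq hY₁ hY₂]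
  constructor
  · intro h t
    rw [preimage_add_right_eq_neg_vadd']
    exact h (-t)
  · intro h t
    have h' := h (-t)
    rwa [preimage_add_right_eq_neg_vadd', neg_neg t] at h'

end ComplexTorus

end Literature.Geometry.Kaehler
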